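import Mathlib
import HarnessLib
import HarnessLib.Audit
import Summits.PneNP.Statement
import Literature.Computability.Complexity.InteractiveProofs
import Literature.Computability.Complexity.Oracle
import Literature.Computability.Complexity.CNF
import Literature.Computability.Complexity.Counting
import Literature.Computability.Complexity.CountingReductions
import Literature.Computability.Complexity.SumcheckCNF
import Literature.Computability.Complexity.Algebrization
import Literature.Computability.Complexity.PolyHierarchy
import Literature.Computability.Complexity.Nondeterministic
import Literature.Computability.Complexity.BoolEncodings
import Literature.Computability.Complexity.InstanceChecker
import HarnessLib.Audit.Status.Attr

/-!
Route: UncheckableSAT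

DORMANT since 2026-08-22T19:43:22Z (reconciler: no traction for 5.6 d (last activity item-evidence-added at 2026-08-17T04:29:21Z); parked, not closed — `ledger route dormant route-PneNP-UncheckableSAT --off` to reactivate) — unstaffed, not closed; items shared with open routes are served there. `ledger route dormant <id> --off` reactivates.

# Route PneNP/UncheckableSAT — "we cannot even check a SAT solver": P ≠ NP from the non-existence of
interactive proofs of unsatisfiability with an NP-powered honest prover (idea card
PneNP/PneNP/uncheckable-sat-prover-ladder)

## Thesis X (it suffices to show)
Words: UNSAT has no interactive proof system (Arora–Barak Def. 8.6: private coins, poly(n) rounds,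
completeness 2/3 with the honest prover, soundness 1/3 against ALL provers) whose HONEST prover is a
deterministic polynomial-time oracle machine with a SAT oracle. This is the single-prover form of
Blum–Kannan's question "can a program claiming to solve SAT be instance-checked?" [BlumKannan1995;
FortnowRompelSipser1994 Cor. 3.2 and §7; BellareGoldwasser1994; AroraBarakCC2009 §8.4 item 2, §8.6]:
"SAT not checkable" ⇒ X (item UncheckableOfNoCompetitiveIP). X is the bottom rung of the
PROVER-POWER LADDER for coNP, X_𝒞 := "no IP for UNSAT with honest prover in FP^𝒞", 𝒞 = NP ⊂ Σ₂ᵖ ⊂ …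
⊂ PH ⊂ #P: the top rung fails (LFKN: an FP^{#P} prover suffices, item SharpPProverSuffices), every
rung below #P is open.
Lean (decl `Thesis`, elaborates): ¬ ∃ (V : IPVerifier) (c : ℕ) (M : List Bool → List Bool),
V.IsPolyTime ∧ M ∈ FPRel (Oracle.ofLanguage SAT) ∧ (∀ x ∈ UNSAT, 2/3 ≤ V.acceptProb (|x|^c) x (msgs
↦ M ⟨x, enc msgs⟩)) ∧ (∀ x ∉ UNSAT, ∀ P, V.acceptProb (|x|^c) x P ≤ 1/3)   [decls:
Literature.Computability.Complexity.IPVerifier / IPProver / IPVerifier.acceptProb /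
IPVerifier.IsPolyTime (InteractiveProofs.lean), FPRel / Oracle.ofLanguage (Oracle.lean), SAT / UNSAT
(CNF.lean), boolPair + Computability.encodingList.listBool for ⟨x, enc msgs⟩].

## Assembly X → PneNP
If ¬PneNP then NP ⊆ P over Wave0, so CplxCore.NP ⊆ CplxCore.P (P_bool_eq_holds, NP_bool_eq_holds),
SAT ∈ P (SAT_mem_NP_holds) and UNSAT ∈ P (decode the encodingCNF code, complement; co_P_holds). The
verifier with 0 coins, next := const [], verdict := {v | (boolUnpair v).1 ∈ UNSAT} ∈ P, together
with the constant prover M := const [] ∈ FP ⊆ FP^SAT (query-free OracleAlg), accepts exactly the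
members of UNSAT with probability 1 whatever the transcript — a protocol X forbids. Only proved tree
theorems are needed; `Assembly := X → PneNP` (no named-fact hypotheses).

Rationale: ## Why this line (interactive proofs/program checking × algebraic query complexity × counting
dichotomies)
X strengthens NP ≠ coNP ("unsatisfiability has no short proofs") to "unsatisfiability has no
interactive proof an NP-powered prover can conduct"; X ⇒ P ≠ NP (Assembly) and X ⇒ NP ≠ coNP (item
ThesisImpliesNPneCoNP: an NP certificate would be found by prefix search with the SAT oracle). It is
Blum–Kannan's 35-year-old question whether NP-complete languages are checkable [BlumKannan1995;
FortnowRompelSipser1994 §7 Q3; BellareGoldwasser1994; AroraBarakCC2009 §8.4 item 2: "open whether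
the protocol can be redesigned to use a weaker prover"], while #P-, PSPACE-, EXP-complete languages
ARE checkable (LFKN/Shamir/BFL). Every known proof of unsatisfiability to a poly-time verifier makes
the honest prover COUNT (AB §8.4: the 3SAT̄ prover "needs at the very least to compute #SAT_D"). The
engine: turn that observation into theorems rung by rung, importing (i) Aaronson–Wigderson algebraic
query complexity [AaronsonWigderson2008 §3–5] — "protocols that see φ only through a low-degree
extension" made precise as ALGEBRIZING protocols (AW fn. 16: φ is recoverable from its
arithmetization by queries, so weaker 'oblivious verifier' classes collapse to X itself); (ii)
weighted counting-CSP dichotomies [BulatovEtAl2009; CaiLuXia2014] — sumcheck with ANY clause-local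
arithmetization is #P-hard-or-inadmissible. The tree has the deterministic sumcheck layer
(SumcheckCNF.lean: Sumcheck.h/H/Accepts/soundness/completeness, proved) and AW's
ExtensionOracle/IsAlgebrizingInclusion, so all 9 typed items elaborate today (Sketch.lean rc 0); no
unproved named fact is a hypothesis anywhere.
## Ranked cruxes
#2 AlgebrizingProversMustCount: ∃ A, Ã and L ∈ coNP^A with no IP whose verifier is poly-time
relative to Ã and whose honest prover is in FP^K, K ∈ NP^Ã — i.e. ¬ IsAlgebrizingInclusion coNPRel
(NP-competent IP). VERBATIM Aaronson–Wigderson's open problem §11(4) (full version p. 47). Necessary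
for X (A = ∅). Since coNP^A ⊆ IP^Ã for all A, Ã (LFKN algebrizes, AW Thm 3.7), a proof must exploit
the prover bound: rigidity of accepted transcripts (cf. SumcheckRigidity) + an algebraic-query lower
bound for counting against NP^Ã-query machines; the cc transfer (AW Thm 4.11) loses the prover
bound, and AW flag coNP-vs-AM / PH-vs-P^#P as hard there ("perhaps the algebraic query version is
easier").
#3 ClauseLocalArithmetizationsCount: for EVERY assignment q of integer polynomials to the 8 sign
patterns of 3-clauses with Q_φ := Π_C q_{signs C}(x_C) having cube-sum 0 exactly on unsatisfiable
width-3 CNFs, #SAT ∈ FP^O where O answers the sumcheck partial sums H_q(φ, integer prefix) of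
UNSATISFIABLE φ only (what SumcheckRigidity forces an honest prover to reveal). LFKN's q is one
instance (HonestFirstMessageCounts: h(2) = −2·#ψ on v ∧ ¬v ∧ ψ). Proof plan: diagonal leak
(vvv)(v̄v̄v̄)∧ψ ↦ q₊(a,a,a)q₋(a,a,a)·Z_q(ψ); Z_q is a mixed-sign weighted Boolean #CSP, #P-hard
unless affine/product type [BulatovEtAl2009 Thm 1; CaiLuXia2014]; show those types are never
admissible.
#4 PHProverSuffices (negative side, staffed deliberately): an IP for UNSAT with honest prover in
FP^K, K ∈ PH. At K ∈ NP it is ¬X (route closed, SAT checkable — big either way); at any PH level it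
refutes the strong ladder thesis and isolates the NP rung.
Support (provable now; validate the frame): SumcheckRigidity; HonestFirstMessageCounts;
ThesisImpliesNPneCoNP; SharpPProverSuffices (non-vacuity of the IP-with-prover template, LFKN over ℤ
= AB Thm 8.21 as in SumcheckCNF.lean); UncheckableOfNoCompetitiveIP (informal Blum–Kannan/FRS
bridge; definition InstanceChecker requested).
## Kill criteria
PHProverSuffices proved with K ∈ NP, or AlgebrizingProversMustCount refuted (NP-powered provers for
coNP^A relative to all A, Ã ⇒ ¬X at A = ∅): close the route (¬X is itself a major theorem: SAT is
checkable). ClauseLocalArithmetizationsCount released 'suspect-false' (an admissible q whose unsat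
partial sums are counting-free): drop the dichotomy line, keep #2. PHProverSuffices at K ∈ Σₖ, k ≥
2: re-rank, thesis unchanged.
## Deliberately NOT decomposed
Structural line "checker ⇒ PH collapse" (Feigenbaum–Fortnow/BogdanovTrevisan2006 need non-adaptive
smooth queries = barrier NPHardnessToOneWayFunctions; prior art MahmoodyXiao2010, acq-01504
pending); the MIP/PCP rung = checkers proper (UNSAT ∉ frIP, FRS94 Cor. 3.2) awaiting
InstanceChecker; private→public coin and round collapse cost the prover one PH level
(GoldwasserSipser1986/BabaiMoran1988) — filed when #2/#3 move; code-based sumcheck [Meir2013] as the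
arithmetization class after #3; approximate-counting (BPP^NP) provers with imperfect completeness.

Novelty: NOVELTY (searched 2026-08-15: lit search --source crossref ×7; lit galaxy search --star all
"checkability of SAT" (8 rows), --star pdf "instance checker"/"competing provers" (FRS94, Meir
TR10-137 read); lit read AaronsonWigderson2008 full version pp. 28–29, 46–47; AroraBarakCC2009 PDF
pp. 195–204; FRS94 pp. 5–6, 10). Nearest prior art: the THESIS is a known open question —
BlumKannan1995 (doi:10.1145/200836.200880), FortnowRompelSipser1994 §7 Q3 ("MIPs for co-NP where the
provers need only answer NP questions? would imply an instance checker for NP-complete problems"),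
BellareGoldwasser1994 (competitive IPs), AroraBarakCC2009 §8.4 item 2, MahmoodyXiao2010
(doi:10.1109/ccc.2010.16; acq-01504). Crux #2 is VERBATIM Aaronson–Wigderson's open problem §11(4)
(p. 47: non-algebrizing techniques needed "to give an interactive protocol for coNP where the prover
has the power of NP?"); no solution found. Crux #3 not in print as searched: Meir2013
(doi:10.1137/110829660) redoes sumcheck with tensor codes, still with a counting prover; the
mixed-sign weighted #CSP dichotomies BulatovEtAl2009, CaiLuXia2014 were never aimed at prover
complexity. DELTA: (checkability of SAT as a typed P≠NP / NP≠coNP thesis with a prover-power ladder)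
⊕ (AW's algebraic-oracle method; their open problem shown NECESSARY for the thesis) ⊕ (counting
dichotomies for "every clause-local arithmetization must count"), typed over
IPVerifier/FPRel/ExtensionOracle/Sumcheck. Expected grade: new-combination.  [refs: 10.1145/200836.200880, 10.1109/ccc.2010.16, 10.1137/110829660, doi:10.1145/200836.200880, doi:10.1109/ccc.2010.16, doi:10.1137/110829660, AaronsonWigderson2008, AroraBarakCC2009, BlumKannan1995, FortnowRompelSipser1994, BellareGoldwasser1994, MahmoodyXiao2010, Meir2013, BulatovEtAl2009, CaiLuXia2014]

Barriers (technique_class: interactive-proofs, prover-complexity, program-checking): technique_class: interactive-proofs, prover-complexity, program-checking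
- Literature.Barriers.PneNP.Algebrization (AW 5.1/5.3): APPLIES to the thesis — X ⇒ P ≠ NP, and for
PSPACE-complete A with extension Ã, P^A = NP^Ã makes SAT^A trivially checkable: every proof of X is
non-algebrizing and non-relativizing. Conceded and made the engine: crux #2 IS "NP-powered provers
for coNP need non-algebrizing techniques" (AW §11(4)), a theorem of the barrier's own type; crux #3
is an unrelativized hardness transfer (#SAT ≤ FP^O) about explicit protocol syntax. Protocols are
the OBJECT here, never the separating tool.
- Literature.Barriers.PneNP.BoundedRelativization (PSPACE-relativizing proofs): same concession for
X (false relative to a PSPACE oracle); #2–#4 are oracle constructions, transfers or explicit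
protocols, none claimed to prove X.
- Literature.Barriers.PneNP.Relativization / Literature.Barriers.PneNP.RelativizationNarrow: X
relativizes in neither direction (FortnowSipser1988: coNP^A ⊄ IP^A makes X^A true; a PSPACE oracle
makes it false); nothing filed relativizes.
- Literature.Barriers.PneNP.NPHardnessToOneWayFunctions (black-box non-adaptive reductions): bites
the structural line "checker ⇒ PH collapse" (checkers are adaptive, not smooth) — hence not a crux
here (MahmoodyXiao2010).
- Literature.Barriers.PneNP.HardnessAmplificationRequiresMajority (ShaltielViola2010): not an
obstruction; the model for the SHAPE of #2/#3 only.
- Literature.Barriers.PneNP.NaturalProofs: no circ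

Novelty grade: new-combination — ROUTE REVIEW (refuter rreview-ab8e18b7, 2026-08-15; FIRST pass, I stamped 9/9 typed items with briefings; 2361 informal). PRECISION: 9/9 elaborate (W3.lean rc0; simp closes no S/¬S). Model audit: IPVerifier extensional (IsPolyTime = next∈FP ∧ verdict∈P, private coins, takeD messages); honest prover  (refuter refuter-rreview-route-PneNP-RamseyAliens-ab8e18b7-0, 2026-08-15T12:20:21Z; prior: doi:10.1145/200836.200880,FortnowRompelSipser1994,BellareGoldwasser1994,AroraBarakCC2009,doi:10.1145/1374376.1374481,doi:10.1109/ccc.2010.16,doi:10.1137/110829660,BulatovEtAl2009,CaiLuXia2014,doi:10.1109/ccc.2004.1313805)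

History (route lifecycle, newest last):
- 2026-08-16T04:14:42Z · AUTO-CRUX (backfill): Thesis — hypotheses of the deciding theorem that nothing in the route derives are cruxes (operator:999:1085951)
- 2026-08-22T19:43:22Z · DORMANT — reconciler: no traction for 5.6 d (last activity item-evidence-added at 2026-08-17T04:29:21Z); parked, not closed — `ledger route dormant route-PneNP-Uncheckabl (operator:999:28265)

sub-problem: PneNP · status: dormant · opened planner-plancard-PneNP-PneNP-uncheckable-sat--b925097f-0 2026-08-15T11:02:53Z · rev 3 · ledger route-PneNP-UncheckableSAT
GENERATED by the gate from the ledger (D-0016/17). Provers cite these decls: `theorem foo : Summit.PneNP.PneNP.Theses.UncheckableSAT.<Decl> := …` in Summits/PneNP/PneNP/Theorems/<Name>.lean.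
-/

namespace Summit.PneNP.PneNP.Theses.UncheckableSAT

open scoped BigOperators Topology Manifold Classical MeasureTheory ProbabilityTheory Matrix InnerProductSpace ComplexConjugate ContinuousMap
open Filter Set Function TopologicalSpace MeasureTheory

attribute [summit_statement] _root_.PneNP

open Literature.PNP

/-- item stmt-PneNP-2298 · crux (kind.auto-crux: conjecture-grade) · rank 0 · open · by planner
why it might fail: False iff SAT is single-prover checkable: an IP for UNSAT with an FP^SAT honest prover contradicts nothing known (no collapse follows by black-box means, MahmoodyXiao2010). X ⇒ P≠NP yet fails relative to PSPACE-complete A with extension Ã (P^A = NP^Ã): any proof is non-relativizing, non-algebrizing.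
sources: BlumKannan1995, FortnowRompelSipser1994, BellareGoldwasser1994, AroraBarakCC2009, MahmoodyXiao2010, AaronsonWigderson2008
[target] UNSAT has no interactive proof (Arora–Barak Def. 8.6 = the tree's IPVerifier: private
coins, |x|^c messages, verifier first; completeness 2/3 with the honest prover, soundness 1/3
against ALL provers) whose honest prover is the uniform strategy msgs ↦ M⟨x, enc msgs⟩ of a
deterministic polynomial-time SAT-oracle machine M ∈ FPRel (Oracle.ofLanguage SAT). Bottom rung X_NP
of the prover-power ladder for coNP (X_𝒞: no IP for UNSAT with honest prover in FP^𝒞; the #P rung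
fails by LFKN, item SharpPProverSuffices; every rung below is open, AroraBarakCC2009 §8.4 item 2).
'SAT has no Blum–Kannan instance checker' ⇒ X (item UncheckableOfNoCompetitiveIP; BlumKannan1995,
FortnowRompelSipser1994 Cor. 3.2/§7 Q3); X ⇒ P ≠ NP (Assembly) and X ⇒ NP ≠ coNP
(ThesisImpliesNPneCoNP). [sources: BlumKannan1995; FortnowRompelSipser1994 §7;
BellareGoldwasser1994; AroraBarakCC2009 §8.4, §8.6; MahmoodyXiao2010] -/
@[route_item "route-PneNP-UncheckableSAT", crux]
def Thesis : Prop :=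
  ¬ ∃ (V : Literature.Computability.Complexity.IPVerifier) (c : ℕ) (M : List Bool → List Bool), V.IsPolyTime ∧ M ∈ Literature.Computability.Complexity.FPRel (Literature.Computability.Complexity.Oracle.ofLanguage Literature.Computability.Complexity.SAT) ∧ (∀ x ∈ Literature.Computability.Complexity.UNSAT, (2 / 3 : ℝ) ≤ V.acceptProb (x.length ^ c) x (fun msgs => M (Literature.Computability.Complexity.boolPair x ((Computability.encodingList Bool).listBool.encode msgs)))) ∧ ∀ x ∉ Literature.Computability.Complexity.UNSAT, ∀ P : Literature.Computability.Complexity.IPProver, V.acceptProb (x.length ^ c) x P ≤ 1 / 3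

/-- item stmt-PneNP-2300 · crux · rank 2 · open · by planner
why it might fail: Open = AW STOC'08 §11(4), p.47: needs an algebraic-oracle lower bound against IPs whose honest prover is NP^Ã-bounded, while coNP^A ⊆ IP^Ã ∀A,Ã (AW Thm 3.7) and the cc transfer (Thm 4.11) ignore prover cost; FALSE iff an algebrizing NP-prover IP for coNP exists (SAT checkable, ¬X).
sources: paper:doi-10-1145-1374376-1374481, AaronsonWigderson2008, LundEtAl1992, FortnowSipser1988, BlumKannan1995
[crux] 'NP-powered provers for coNP do not algebrize' = VERBATIM Aaronson–Wigderson's open problem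
§11(4) (p. 47). ¬ IsAlgebrizingInclusion coNPRel D with D O := languages having an interactive proof
whose verifier is poly-time relative to O (next ∈ FP^O, verdict ∈ P^O; private coins, |x|^c
messages; soundness 1/3 vs ALL provers) and whose honest prover is msgs ↦ M⟨x, enc msgs⟩, M ∈ FP^K
for some K ∈ NP^O. Unfolded: ∃ A, Ã and L ∈ coNP^A with no such protocol relative to Ã. NECESSARY
for the Thesis (A = ∅, Ã = 0, up to FP^NP = FP^SAT). Precise form of the card's K1/K2: weaker
'oblivious verifier' classes collapse to X (AW fn. 16: φ is recoverable from its arithmetization by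
queries), while coNP^A ⊆ IP^Ã for ALL A, Ã (LFKN algebrizes, AW Thm 3.7) — so a proof must USE the
prover bound: rigidity of accepted transcripts (cf. SumcheckRigidity) + an algebraic-query lower
bound for counting against NP^Ã-query machines (AW Lemma 4.5-type); the cc transfer (AW 4.11)
forgets prover efficiency. Proof = a new barrier theorem; refutation makes SAT checkable (kill).
[sources: AaronsonWigderson2008 §3, §4, §11(4); LundEtAl1992; FortnowSipser1988; BlumKannan1995] -/
@[route_item "route-PneNP-UncheckableSAT"]
def AlgebrizingProversMustCount : Prop :=
  ¬ Literature.Computability.Complexity.IsAlgebrizingInclusion Literature.Computability.Complexity.coNPRel (fun O => {L | ∃ (V : Literature.Computability.Complexity.IPVerifier) (c : ℕ) (M : List Bool → List Bool) (K : Language Bool), K ∈ Literature.Computability.Complexity.NPRel O ∧ M ∈ Literature.Computability.Complexity.FPRel (Literature.Computability.Complexity.Oracle.ofLanguage K) ∧ V.next ∈ Literature.Computability.Complexity.FPRel O ∧ V.verdict ∈ Literature.Computability.Complexity.PRel O ∧ (∀ x ∈ L, (2 / 3 : ℝ) ≤ V.acceptProb (x.length ^ c) x (fun msgs => M (Literature.Computability.Complexity.boolPair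 x ((Computability.encodingList Bool).listBool.encode msgs)))) ∧ ∀ x ∉ L, ∀ P : Literature.Computability.Complexity.IPProver, V.acceptProb (x.length ^ c) x P ≤ 1 / 3})

/-- item stmt-PneNP-2302 · crux · rank 4 · open · by planner
why it might fail: Presumably FALSE (AB §8.4(2): open whether a weaker prover suffices): all known IPs for UNSAT (LFKN/Shamir, Meir2013) need exact counting; BPP^NP approximation gives no exact identities; GS86/BM88 cost a PH level; polylog rounds collapse EH (SelmanSengupta2004). Irrefutable short of X_PH.
sources: AroraBarakCC2009, LundEtAl1992, Meir2013, FortnowRompelSipser1994, BellareGoldwasser1994, GoldwasserSipser1986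
[crux][negative side of the ladder, staffed deliberately] There IS an interactive proof for UNSAT
(template of the Thesis: IPVerifier.IsPolyTime, completeness 2/3 with the uniform honest prover,
soundness 1/3 vs all provers) whose honest prover is in FP^K for some K ∈ PH. LFKN/Shamir give
FP^{#P} (item SharpPProverSuffices); nothing lower is known (AroraBarakCC2009 §8.4 item 2;
FortnowRompelSipser1994 §7 Q3). At K ∈ NP this is ¬Thesis: route closed (SAT checkable — major
either way); at any PH level it refutes the strong ladder thesis X_PH and pins the phenomenon to the
NP rung (re-rank, thesis unchanged). Guidance: constant-round public-coin protocols are hopeless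
unless PH collapses (coNP ⊆ AM ⇒ PH = Σ₂ᵖ), and Goldwasser–Sipser / Babai–Moran transformations cost
the prover one PH level (approximate counting of verifier coins ∈ BPP^NP), so a construction must be
genuinely many-round; partial results worth attaching: FP^{ModₖP} provers, or BPP^NP provers with
imperfect completeness. [sources: AroraBarakCC2009 §8.4; LundEtAl1992; BellareGoldwasser1994;
FortnowRompelSipser1994; GoldwasserSipser1986; BabaiMoran1988] -/
@[route_item "route-PneNP-UncheckableSAT"]
def PHProverSuffices : Prop :=
  ∃ (V : Literature.Computability.Complexity.IPVerifier) (c : ℕ) (M : List Bool → List Bool) (K : Language Bool), K ∈ Literature.Computability.Complexity.PH ∧ M ∈ Literature.Computability.Complexity.FPRel (Literature.Computability.Complexity.Oracle.ofLanguage K) ∧ V.IsPolyTime ∧ (∀ x ∈ Literature.Computability.Complexity.UNSAT, (2 / 3 : ℝ) ≤ V.acceptProb (x.length ^ c) x (fun msgs => M (Literature.Computability.Complexity.boolPair x ((Computability.encodingList Bool).listBool.encode msgs)))) ∧ ∀ x ∉ Literature.Computability.Complexity.UNSAT, ∀ P : Literature.Computability.Complexity.IPProver, V.acceptProb (x.length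 ^ c) x P ≤ 1 / 3

/-- item stmt-PneNP-2301 · support · rank 3 · open · by planner
why it might fail: Steps (ii)-(iii) may need the full mixed-sign #CSP dichotomy (not in the tree) or fail for exotic signed admissible q with cancellations; unrefutable short of #P ⊄ FP^O, so failure shows as suspect-false: an admissible q whose unsat partial sums carry no counting information.
sources: AroraBarakCC2009, LundEtAl1992
[crux] 'Every clause-local arithmetization makes the sumcheck prover count.' q gives each sign
pattern s : Fin 3 → Bool a polynomial q_s ∈ ℤ[X₀,X₁,X₂]; a length-3 clause C contributes q_{signs
C}(x_{v₀},x_{v₁},x_{v₂}) (others 1), Q_φ := Π_C (LFKN: q_s = 1 − Π(1−ℓᵢ)); H_q(φ, pref) := cube sum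
of Q_φ with the first |pref| variables of varList φ set to the integers pref. Admissible: for all
width-3 φ (CNF.IsWidthEq 3), H_q(φ,[]) = 0 ↔ ¬φ.Satisfiable (what makes sumcheck for 'Σ Q_φ = 0'
prove unsatisfiability). Claim: #SAT ∈ FP^O for O⟨code φ, code pref⟩ := code of H_q(φ, pref)
answered ONLY on unsatisfiable width-3 φ — the values SumcheckRigidity forces an honest prover to
reveal where completeness binds it (LFKN's q: HonestFirstMessageCounts). Plan: (i) diagonal leak, φ
= (vvv)(v̄v̄v̄) ∧ ψ gives q₊₊₊(a,a,a)·q₋₋₋(a,a,a)·Z_q(ψ) with a nonzero scalar polynomial by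
admissibility; (ii) Z_q = mixed-sign weighted Boolean #CSP, #P-hard unless affine/product type
[BulatovEtAl2009 Thm 1; CaiLuXia2014]; (iii) such types are never admissible (else 3-SAT ∈ P); (iv)
parsimonious padding to width 3. [sources: LundEtAl1992; AroraBarakCC2009 §8.3; BulatovEtAl2009;
CaiLuXia2014; Meir2013] -/
@[route_item "route-PneNP-UncheckableSAT"]
def ClauseLocalArithmetizationsCount : Prop :=
  ∀ q : (Fin 3 → Bool) → MvPolynomial (Fin 3) ℤ, let H : Literature.Computability.Complexity.CNF ℕ → List ℤ → ℤ := fun φ pref => Literature.Computability.Complexity.Sumcheck.cubeSum ((Literature.Computability.Complexity.Sumcheck.varList φ).length - pref.length) (fun xs => (φ.map fun c : Literature.Computability.Complexity.Clause ℕ => if c.length = 3 then MvPolynomial.eval (fun i : Fin 3 => Literature.Computability.Complexity.Sumcheck.pt (Literature.Computability.Complexity.Sumcheck.varList φ) (pref ++ xs) (c.getD i.val (0, false)).1) (q fun i : Fin 3 => (c.getD i.val (0, false)).2) else (1 : ℤ)).prod); (∀ φ : Literature.Computability.Complexity.CNF ℕ, Literature.Computability.Complexity.CNF.IsWidthEq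 3 φ → (H φ [] = 0 ↔ ¬ φ.Satisfiable)) → (Computability.encodeNat ∘ Literature.Computability.Complexity.SHARPSAT) ∈ Literature.Computability.Complexity.FPRel (fun w => match Literature.Computability.Complexity.encodingCNF.decode (Literature.Computability.Complexity.boolUnpair w).1, Literature.Computability.Complexity.encodingIntBool.listBool.decode (Literature.Computability.Complexity.boolUnpair w).2 with | some φ, some pref => if Literature.Computability.Complexity.CNF.IsWidthEq 3 φ ∧ ¬ φ.Satisfiable then Literature.Computability.Complexity.encodingIntBool.encode (H φ pref) else [] | _, _ => [])

/-- item stmt-PneNP-2303 · support · rank 9 · closed · proved by Summit.PneNP.PneNP.Theorems.uncheckableSAT_sumcheckRigidity_proof @ 29fbec989658 (prover) · by planner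
sources: AroraBarakCC2009, LundEtAl1992
[support] Rigidity of the tree's integer sumcheck (SumcheckCNF.lean): if a prover strategy S
(challenge prefix ↦ next univariate polynomial of degree ≤ size φ) passes Sumcheck.Accepts with the
TRUE claim H(φ,[]) for EVERY challenge vector in R^n, |R| > size φ, n = |varList φ|, then S equals
the honest Sumcheck.h on every proper prefix from R. Backward induction: last round (S p)(a) =
P_φ(p, a) = (h p)(a) for all a ∈ R (H_full, eval_h) forces S p = h p (card_filter_isRoot_le);
earlier rounds via h_zero_add_h_one and the consistency check. Deterministic core of 'accepted
provers are honest provers'; the probabilistic form (acceptance probability > n·size φ/|R| pins the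
first message) follows with Sumcheck.soundness. [sources: AroraBarakCC2009 Thm 8.21; LundEtAl1992] -/
@[route_item "route-PneNP-UncheckableSAT"]
def SumcheckRigidity : Prop :=
  ∀ (φ : Literature.Computability.Complexity.CNF ℕ) (R : Finset ℤ) (S : List ℤ → Polynomial ℤ), φ.size < R.card → (∀ pref : List ℤ, (S pref).natDegree ≤ φ.size) → (∀ r : List ℤ, r.length = (Literature.Computability.Complexity.Sumcheck.varList φ).length → (∀ a ∈ r, a ∈ R) → Literature.Computability.Complexity.Sumcheck.Accepts φ (Literature.Computability.Complexity.Sumcheck.varList φ) (Literature.Computability.Complexity.Sumcheck.H φ (Literature.Computability.Complexity.Sumcheck.varList φ) []) (fun i => S (r.take i)) r) → ∀ r : List ℤ, r.length < (Literature.Computability.Complexity.Sumcheck.varList φ).length → (∀ a ∈ r, a ∈ R) → S r = Literature.Computability.Complexity.Sumcheck.h φ (Literature.Computability.Complexity.Sumcheck.varList φ) r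

/-- item stmt-PneNP-2304 · support · rank 9 · closed · proved by Summit.PneNP.PneNP.Theorems.uncheckableSAT_honestFirstMessageCounts_proof @ a8f9106c7462 (prover) · by planner
sources: AroraBarakCC2009, LundEtAl1992
[support] 'For LFKN itself the prover must count', literally, in the tree's integer sumcheck: for ψ
not mentioning v, φ = (v) ∧ (¬v) ∧ ψ is unsatisfiable and the honest first polynomial satisfies
h_φ(2) = Σ_b 2·(1−2)·P_ψ(b) = −2·#ψ (clauseVal at 2 of (v) is 2, of (¬v) is −1; varList φ = v ::
varList ψ; H_nil_eq_card / numSat over ψ.vars). So one query to any oracle answering the honest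
prover's FIRST message on UNSAT inputs computes #SAT: the rank-0 rung of the ladder and the sanity
check behind cruxes #2/#3. [sources: AroraBarakCC2009 §8.3.2 (8.9); LundEtAl1992] -/
@[route_item "route-PneNP-UncheckableSAT"]
def HonestFirstMessageCounts : Prop :=
  ∀ (ψ : Literature.Computability.Complexity.CNF ℕ) (v : ℕ), v ∉ ψ.vars → (Literature.Computability.Complexity.Sumcheck.h ([(v, true)] :: [(v, false)] :: ψ) (Literature.Computability.Complexity.Sumcheck.varList ([(v, true)] :: [(v, false)] :: ψ)) []).eval 2 = -2 * (ψ.numSat : ℤ)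

/-- item stmt-PneNP-2305 · support · rank 9 · closed · proved by Summit.PneNP.PneNP.Theorems.uncheckableSAT_thesisImpliesNPneCoNP_proof @ 7b4b417e9a53 (prover) · by planner
sources: BellareGoldwasser1994, AroraBarakCC2009
[support] X ⇒ NP ≠ coNP (links the route to PneNP/proofcplx). If NP = coNP then UNSAT ∈ NP with a
P-time certificate relation R and length bound p: the verifier sends one dummy message and accepts
iff the prover's answer is a certificate (msgLen ≥ p; the finitely many inputs with |x|^c < 2
hard-wired into the verdict); the honest prover returns the lexicographically first certificate
found by prefix search, each test '∃ completion of this prefix' being an NP language Karp-reduced to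
SAT (SAT_isNPHard_holds), so M ∈ FP^SAT (one OracleAlg, poly(|x|) queries); soundness: off UNSAT no
certificate exists, acceptance probability 0. [sources: BellareGoldwasser1994 §1; AroraBarakCC2009
§2.5, Def. 8.6] -/
@[route_item "route-PneNP-UncheckableSAT"]
def ThesisImpliesNPneCoNP : Prop :=
  (¬ ∃ (V : Literature.Computability.Complexity.IPVerifier) (c : ℕ) (M : List Bool → List Bool), V.IsPolyTime ∧ M ∈ Literature.Computability.Complexity.FPRel (Literature.Computability.Complexity.Oracle.ofLanguage Literature.Computability.Complexity.SAT) ∧ (∀ x ∈ Literature.Computability.Complexity.UNSAT, (2 / 3 : ℝ) ≤ V.acceptProb (x.length ^ c) x (fun msgs => M (Literature.Computability.Complexity.boolPair x ((Computability.encodingList Bool).listBool.encode msgs)))) ∧ ∀ x ∉ Literature.Computability.Complexity.UNSAT, ∀ P : Literature.Computability.Complexity.IPProver, V.acceptProb (x.length ^ c) x P ≤ 1 / 3) → Literature.Computability.Complexity.Nondeterministic.NP ≠ Literature.Computability.Complexity.coNP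

/-- item stmt-PneNP-2306 · support · rank 9 · open · by planner
sources: LundEtAl1992, AroraBarakCC2009
[support][non-vacuity of the template, one rung up] LFKN in the tree's model: UNSAT has an
interactive proof (IPVerifier; coins = the challenge blocks) whose honest prover is in FP^f for a #P
function f (FPRel (Oracle.ofFun f)). Verifier = Arthur of SumcheckMASpec/SumcheckMAReferee run
interactively: challenges read off coin blocks of length blockLen, messages decoded with
decodeCoeffs, acceptance = Sumcheck.Accepts with claim 0; soundness ≤ n·size φ/2^ℓ ≤ 1/4 from
Sumcheck.soundness + uniformProb_exists_badBlock_le, completeness 1 from Sumcheck.completeness; the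
prover sends encodeCoeffs of Sumcheck.h φ vl (decoded prefix), whose coefficients are signed cube
sums (GapP values) computable with one #P oracle (two counts per coefficient, or honestLang-style
bit queries). Shows the Thesis' ∃-template is inhabited with a counting prover (AB Thm 8.21, §8.4),
so X is not an artefact of the formalisation. [sources: LundEtAl1992; AroraBarakCC2009 Thm 8.21,
§8.4] -/
@[route_item "route-PneNP-UncheckableSAT"]
def SharpPProverSuffices : Prop :=
  ∃ (V : Literature.Computability.Complexity.IPVerifier) (c : ℕ) (M : List Bool → List Bool) (f : List Bool → ℕ), f ∈ Literature.Computability.Complexity.SharpP ∧ M ∈ Literature.Computability.Complexity.FPRel (Literature.Computability.Complexity.Oracle.ofFun f) ∧ V.IsPolyTime ∧ (∀ x ∈ Literature.Computability.Complexity.UNSAT, (2 / 3 : ℝ) ≤ V.acceptProb (x.length ^ c) x (fun msgs => M (Literature.Computability.Complexity.boolPair x ((Computability.encodingList Bool).listBool.encode msgs)))) ∧ ∀ x ∉ Literature.Computability.Complexity.UNSAT, ∀ P : Literature.Computability.Complexity.IPProver, V.acceptProb (x.length ^ c) x P ≤ 1 / 3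

/-- item stmt-PneNP-2361 · support · rank 9 · open · by planner
[support] Blum–Kannan bridge, informal until the definition InstanceChecker lands. (a) SAT has an
instance checker (BlumKannan1995 §2; AroraBarakCC2009 Def. 8.26) iff SAT and UNSAT both have
function-restricted interactive proofs (BlumKannan1995 Thm; FortnowRompelSipser1994 §3 with Cor.
3.2: frIP = MIP whose honest provers only answer queries about the language); SAT ∈ frIP by
self-reducibility. (b) ¬Thesis — a single-prover IP for UNSAT whose honest prover is in FP^SAT and
which is sound against ADAPTIVE provers — gives UNSAT ∈ frIP (compose the verifier with the prover's
oracle machine; a cheating function-oracle induces a cheating adaptive prover), hence SAT checkable.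
So 'SAT has no instance checker' ⇒ Thesis, and the MIP rung 'UNSAT ∉ frIP' is the card's title
statement ('we cannot even check a SAT solver'); the converse Thesis ⇒ uncheckable is open (single-
vs multi-prover with efficient provers, FortnowRompelSipser1994 §7 Q3). To be typed as: (∃
competitive IP for UNSAT as in ¬Thesis) → InstanceCheckable SAT. [sources: BlumKannan1995;
FortnowRompelSipser1994 §3, Cor. 3.2, §7; AroraBarakCC2009 §8.6 Def. 8.26, Thm 8.29] -/
@[route_item "route-PneNP-UncheckableSAT"]
def UncheckableOfNoCompetitiveIP : Prop :=
  (∃ (V : Literature.Computability.Complexity.IPVerifier) (c : ℕ) (M : List Bool → List Bool), V.IsPolyTime ∧ M ∈ Literature.Computability.Complexity.FPRel (Literature.Computability.Complexity.Oracle.ofLanguage Literature.Computability.Complexity.SAT) ∧ (∀ x ∈ Literature.Computability.Complexity.UNSAT, (2 / 3 : ℝ) ≤ V.acceptProb (x.length ^ c) x (fun msgs => M (Literature.Computability.Complexity.boolPair x ((Computability.encodingList Bool).listBool.encode msgs)))) ∧ ∀ x ∉ Literature.Computability.Complexity.UNSAT, ∀ P : Literature.Computability.Complexity.IPProver, V.acceptProb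 (x.length ^ c) x P ≤ 1 / 3) → Literature.Computability.Complexity.InstanceCheckable Literature.Computability.Complexity.SAT

/-- item stmt-PneNP-2299 · assembly · rank 1 · closed · proved by Summit.PneNP.PneNP.Theorems.uncheckableSAT_assembly_proof @ 50da4763b953 (prover) · by planner
sources: AroraBarakCC2009
[assembly] X → PneNP, X inlined. If ¬PneNP then every Wave0-NP language is in Wave0-P, so
CplxCore.NP ⊆ CplxCore.P (P_bool_eq_holds, NP_bool_eq_holds), SAT ∈ P (SAT_mem_NP_holds) and UNSAT ∈
P (decode the encodingCNF code and complement; co_P_holds). Protocol: coins := 0, next := const [],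
verdict := {v | (boolUnpair v).1 ∈ UNSAT} ∈ P; prover M := const [] ∈ FP ⊆ FP^SAT (query-free
OracleAlg, cf. P_subset_PRel_holds). Acceptance ignores the transcript: probability 1 on UNSAT
(uniformProb of the full cube), 0 elsewhere — a protocol X forbids (any c works). Only proved tree
theorems are needed; no named-fact hypotheses. [sources: AroraBarakCC2009 §2.6.1, Def. 8.6] -/
@[route_item "route-PneNP-UncheckableSAT", crux]
def Assembly : Prop :=
  (¬ ∃ (V : Literature.Computability.Complexity.IPVerifier) (c : ℕ) (M : List Bool → List Bool), V.IsPolyTime ∧ M ∈ Literature.Computability.Complexity.FPRel (Literature.Computability.Complexity.Oracle.ofLanguage Literature.Computability.Complexity.SAT) ∧ (∀ x ∈ Literature.Computability.Complexity.UNSAT, (2 / 3 : ℝ) ≤ V.acceptProb (x.length ^ c) x (fun msgs => M (Literature.Computability.Complexity.boolPair x ((Computability.encodingList Bool).listBool.encode msgs)))) ∧ ∀ x ∉ Literature.Computability.Complexity.UNSAT, ∀ P : Literature.Computability.Complexity.IPProver, V.acceptProb (x.length ^ c) x P ≤ 1 / 3) → PneNP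

/-! D-0027 §2.1 — DECIDING THEOREM (planner-authored via `route open/edit --closes-file`; by planner-rbadge-PneNP-UncheckableSAT-fec72867-g2-0 2026-08-15T16:16:47Z):
its hypotheses are this route's items and its conclusion the sub-problem Statement (glue_lint), and it elaborates with this file. -/

@[closes "route-PneNP-UncheckableSAT"] theorem closes (hT : Thesis) (hA : Assembly) : _root_.PneNP := hA hT

end Summit.PneNP.PneNP.Theses.UncheckableSAT
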